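import Mathlib
import HarnessLib
import Summits.HodgeConjecture.HodgeConjecture.Theses.LinearSystemTorelli
import Literature.AlgebraicGeometry.HodgeTheory.FermatDiagonalAction
import Literature.AlgebraicGeometry.HodgeTheory.FermatHypersurfaceReduction
import Literature.AlgebraicGeometry.HodgeTheory.FermatHodgeCharacters

/-!
# Line `isotypic-pencil-support` for the crux `LinearSystemTorelli.MiddleDivisorSupportFourfold`
(stmt-HodgeConjecture-2409) — crux-plan verdict: **NO SKELETON** (sector lever; record file)

This file is NOT a skeleton: it registers no `stub_*` and has no `MiddleDivisorSupportFourfold_of`.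
It records, kernel-checked, (1) why the idea cannot be composed into a concluding skeleton without
a COSTUME stub, and (2) the typed SECTOR statements the lever does bear on (Fermat battleground),
with the triage correction (Galois closure = `FermatCharacter.IsHodge`), for re-homing as support
items on the Fermat routes. The line card `Lines/isotypic-pencil-support.md` and the experiment
report `Lines/isotypic-pencil-support-experiment.md` carry the evidence (m = 33 pencil census).

(1) The crux is `∀ X` (every smooth projective fourfold, every rational `(2,2)`-class) and is
HC(4,2) in support form (lead's certificate `crux_iff_hc42`, `Lines/Sketch.lean` v4, p108510).
The lever (equivariant Leray vanishing over an invariant pencil) proves divisor support only for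
classes in the `K`-isotypic part of `H⁴` of a fourfold WITH a finite group of polarised
automorphisms — a predicate `S` on pairs `(X, c)`. `cruxOn_split` below is the two-line fact that
for EVERY predicate `S` the crux is `CruxOn S ∧ CruxOn Sᶜ`; so a skeleton
`stub_sector : CruxOn S`, `stub_complement : CruxOn Sᶜ` has `stub_complement` implied by the crux
and implying it modulo the sector theorem — it IS the crux on the complement (automorphism-free
fourfolds, trivial isotypic components: every hard case), i.e. the certified costume of
`Lines/Sketch-dead.md` §1. No transfer makes `Sᶜ` empty: classes descended from a Galois cover are
invariant, and the trivial character is never omitted by any invariant pencil (`H⁰` of a member).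

(2) Sector statements (all `Prop`s, nothing asserted): `PairedTailSupported m` (calibration =
Shioda type I, TRUE for every `α`, provable by the pencil `{x₅ = λx₄}`), `FermatHodgeCharacterSupported m`
(the corrected sector target: Hodge characters `𝔅⁴ₘ`; with DivisorInduction (3,2) + Lefschetz (1,1)
it is HC for `X⁴ₘ`, open at `m = 33`), `Fermat33SporadicSupported` (da Silva's sporadic orbit in
support form — what a successful invariant pencil would have delivered; the census of this session
finds NO invariant pencil of degree ≤ 2 omitting it).
-/

namespace Summit.HodgeConjecture.HodgeConjecture.Cruxes.MiddleDivisorSupportFourfold.IsotypicPencilSupport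

open Literature.AlgebraicGeometry.Motives Literature.AlgebraicGeometry.HodgeTheory

/-! ### (1) Sector + complement = crux, for every sector: the costume certificate -/

/-- The crux restricted to a class `S` of pairs (fourfold, degree-4 class). -/
def CruxOn (S : ∀ X : SchemeOver ℂ, complexBetti X 4 → Prop) : Prop :=
  ∀ ⦃X : SchemeOver ℂ⦄, IsSmoothProjective 4 X → ∀ c : complexBetti X 4, S X c →
    IsRationalClass c → IsOfHodgeType 4 X 4 2 2 c → c ∈ supportedClasses X 4 1

/-- For every sector `S`: crux ↔ (crux on `S`) ∧ (crux on the complement of `S`). Hence in any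
skeleton "sector stub + complement stub ⟹ crux" the complement stub is implied by the crux and,
given the sector theorem, implies it: it restates the crux on `Sᶜ` (COSTUME). -/
theorem cruxOn_split (S : ∀ X : SchemeOver ℂ, complexBetti X 4 → Prop) :
    Summit.HodgeConjecture.HodgeConjecture.Theses.LinearSystemTorelli.MiddleDivisorSupportFourfold ↔
      CruxOn S ∧ CruxOn (fun X c => ¬ S X c) := by
  constructor
  · intro h
    exact ⟨fun X hX c _ hc hh => h hX c hc hh, fun X hX c _ hc hh => h hX c hc hh⟩
  · rintro ⟨hS, hT⟩ X hX c hc hh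
    by_cases hs : S X c
    · exact hS hX c hs hc hh
    · exact hT hX c hs hc hh

/-- In particular the complement stub alone is never smaller than the crux: crux ⟹ complement. -/
theorem cruxOn_compl_of_crux (S : ∀ X : SchemeOver ℂ, complexBetti X 4 → Prop)
    (h : Summit.HodgeConjecture.HodgeConjecture.Theses.LinearSystemTorelli.MiddleDivisorSupportFourfold) :
    CruxOn (fun X c => ¬ S X c) :=
  ((cruxOn_split S).1 h).2

/-! ### (2) The sector statements the lever bears on (Fermat battleground) -/

/-- CALIBRATION (Shioda type I, cycle-free): on `X⁴ₘ = V₊(Σ xᵢᵐ) ⊂ ℙ⁵` every eigenspace `V(α)` with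
a PAIRED TAIL `α₄ + α₅ = 0` is divisor-supported — by equivariant Leray over the pencil
`{x₅ = λ x₄}` (stable under `H = {ζ₄ = ζ₅}`; smooth members = Fermat threefolds whose characters
have all five entries non-zero, so `χ_α|_H = (α₀,…,α₃, α₄+α₅)` is omitted iff `α₄ + α₅ = 0`), on
the `m` cone members `λᵐ = -1`. True for every `α` (non-admissible `α`: `V(α) = ⊥` or `ℂ·h²`).
This session's computation reproduces the omission set `{α₄ + α₅ = 0}` EXACTLY from the
fixed-point formula (all 3125 characters at `m = 5`; samples at `m = 6, 7`).
[cite: Shioda1979HodgeFermat, Thm. I] [cite: arXiv:2101.04739, Thm 2.2 / Cor 2.3 (P1)] -/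
def PairedTailSupported (m : ℕ) [NeZero m] : Prop :=
  ∀ α : Fin (4 + 2) → ZMod m, α 4 + α 5 = 0 →
    fermatEigenspace m α 4 ≤ supportedClasses (fermatHypersurface 4 m) 4 1

/-- SECTOR TARGET, corrected per triage r1-1 (the Galois closure is built into
`FermatCharacter.IsHodge`: admissible and `2|tα| = 6m` for every unit `t`, Shioda's `𝔅⁴ₘ`): every
eigenspace of a Hodge character of `X⁴ₘ` is divisor-supported. (The un-closed version "all classes
of `V(α)` of type (2,2)" is FALSE at `m = 7`, `α = (3,3,3,3,3,6)`: `V(5α) = H^{4,0}`.) With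
`DivisorInduction (3,2)` + Lefschetz `(1,1)` this is HC for `X⁴ₘ`; open at `m = 33`. -/
def FermatHodgeCharacterSupported (m : ℕ) [NeZero m] : Prop :=
  ∀ α : Fin (4 + 2) → ZMod m, FermatCharacter.IsHodge α →
    fermatEigenspace m α 4 ≤ supportedClasses (fermatHypersurface 4 m) 4 1

/-- The `m = 33` sporadic orbit (da Silva arXiv:2101.04739 Prop. 3.6; unit class of
`(1,4,16,22,25,31)` = of `(7,10,13,19,22,28)`, the customer `DerivedTorelliFermat.Fermat33AccidentalClass`)
in SUPPORT form: what an `H`-invariant pencil omitting `χ_α|_H` would have proved. Census of this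
session (fixed-point character formula, validated on the type-I calibration): hyperplane pencils
cannot omit it (no complementary pair); the 45 partition-binomial pencils `xᵢxⱼ = λxₖxₗ` give
multiplicity 2 in `H³` of the generic (33-nodal) member for all 20 twists; the 60 pencils
`xᵢ² = λxⱼxₖ` give multiplicity 1 or 2; diagonal (full-torus) pencils omit nothing. So no invariant
pencil of degree ≤ 2 reaches it — recorded as an open sector statement, not claimed. -/
def Fermat33SporadicSupported : Prop :=
  ∀ α : Fin (4 + 2) → ZMod 33,
    (∃ t : (ZMod 33)ˣ, Finset.univ.val.map α =
      (({1, 4, 16, 22, 25, 31} : Multiset (ZMod 33)).map fun a => (t : ZMod 33) * a)) →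
    fermatEigenspace 33 α 4 ≤ supportedClasses (fermatHypersurface 4 33) 4 1

/-- The corrected sector target contains the calibration on Hodge characters with a paired tail
(trivial bookkeeping, recorded so the two statements are visibly nested). -/
theorem pairedTail_of_hodgeCharacterSupported {m : ℕ} [NeZero m]
    (h : FermatHodgeCharacterSupported m) (α : Fin (4 + 2) → ZMod m)
    (hα : FermatCharacter.IsHodge α) (_h45 : α 4 + α 5 = 0) :
    fermatEigenspace m α 4 ≤ supportedClasses (fermatHypersurface 4 m) 4 1 :=
  h α hα

/-- Sanity (direction crux ⟹ sector, rational classes): the crux gives divisor support of every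
RATIONAL `(2,2)`-class on `X⁴ₘ` (`m ≥ 1`); the eigenspace statements above follow from it only
through the `ℚ`-structure of `⊕ₜ V(tα)` (`fermatProjector`), not proved here. -/
theorem fermat_rational_of_crux {m : ℕ} (hm : 1 ≤ m)
    (h : Summit.HodgeConjecture.HodgeConjecture.Theses.LinearSystemTorelli.MiddleDivisorSupportFourfold)
    (c : complexBetti (fermatHypersurface 4 m) 4) (hc : IsRationalClass c)
    (hh : IsOfHodgeType 4 (fermatHypersurface 4 m) 4 2 2 c) :
    c ∈ supportedClasses (fermatHypersurface 4 m) 4 1 :=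
  h (isSmoothHypersurface_fermatHypersurface (by norm_num) hm).1 c hc hh

end Summit.HodgeConjecture.HodgeConjecture.Cruxes.MiddleDivisorSupportFourfold.IsotypicPencilSupport
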